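import Mathlib.GroupTheory.Index
import Mathlib.GroupTheory.OrderOfElement
import Mathlib.GroupTheory.Perm.Cycle.Type
import Literature.NumberTheory.ComplexMultiplication.CMLatticeRingClassTowerTwoOverClassGroup
import Literature.NumberTheory.QuadraticFields.RingClassForms
import Literature.NumberTheory.EllipticCurves.Tian2014.CongruentNumbersHeegnerPoints
import HarnessLib

/-!
# The `4`-rank-ONE criterion: a square-class `κ` generating an order-two kernel is a `g`-th power of a
# square iff the `4`-rank is exactly one — and its reading on `Pic(𝒪₂) → Cl(𝒪_K)` of an imaginary
# quadratic field with even discriminant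

Topic `NumberTheory/QuadraticFields`, namespace `Literature.NumberTheory.QuadraticFields.FourRankOne`
(companion of `RedeiReichardtGroupLemmas.lean` / `RedeiMatrixFourRank.lean`, which compute the tree's
`Tian2014.fourTwoCard G = #(G² ∩ G[2]) = 2^{r₄(G)}`).  THEOREMS ONLY: no definition, no named fact, no
`sorry` (D-0026; net Literature debt 0).  Cell `bsd-print-cf2`, seat `bsd-print-cf2-ty2` (typer).

## What is proved

§1 (pure group theory, finite abelian groups written multiplicatively).  Let `S` be a finite abelian
group of order `2m` and `κ ∈ S` an involution (`κ ≠ 1`, `κ² = 1`).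
* `eq_one_or_eq_of_pow_eq` — if `x^m = κ` for some `x ∈ S`, then `κ` is the ONLY involution of `S`
  (`⟨x⟩` has odd index, so every involution lies in the cyclic group `⟨x⟩`).
* `exists_pow_eq_of_forall_sq_eq_one` — conversely, if `κ` is the only involution of `S`, then
  `x^m = κ` for some `x` (induction on `m` through the squaring map `S → S²`, whose kernel is `{1, κ}`;
  Cauchy's theorem puts `κ` in `S²`).
* `exists_pow_eq_iff_forall_sq_eq_one`, `exists_pow_eq_iff_natCard_sq_eq_one_eq_two` — the criterion
  «`∃ x, x^m = κ` ⟺ `S[2] = {1, κ}` ⟺ `#S[2] = 2`».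
* `exists_isSquare_pow_eq_iff_fourTwoCard_eq_two` — THE PACKAGED FORM used downstream: for a surjection
  `π : G ↠ C` of finite abelian groups with `ker π = {1, κ}`, `κ ≠ 1` a SQUARE, and `g := #C²` the number
  of squares of `C`:  **`(∃ x ∈ G², x^g = κ) ⟺ fourTwoCard G = 2`** (i.e. the `4`-rank of `G` is
  exactly `1`).  Here `S = G²` has order `2g` (it maps onto `C²` with kernel `{1, κ}`) and
  `S[2] = G² ∩ G[2]`.  Also the trivial sufficient condition `exists_isSquare_pow_eq_of_odd` (`g` odd:
  take `x = κ`).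

§2 (the conductor-`2` ring class group).  For an imaginary quadratic field `K` (`[K:ℚ] = 2`, `d_K < 0`)
with `d_K` even and `d_K ≠ −4` — so `2` ramifies, `𝒪_K^× = {±1}`, and by Cox's Thm. 7.24
`h(𝒪₂) = 2h(𝒪_K)` (tree `CMTypeLattice.natCard_ker_toClassGroup_two_pow_of_even`): the change-of-conductor
map `toClassGroup K 2 : I_K(2)/P_{K,ℤ}(2) → Cl(𝒪_K)` is onto (`toClassGroup_surjective_of_discr_neg`, any
conductor, from the tree's `RingClass.toClassGroup_surjective`) with kernel `{1, κ}` for any non-trivial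
kernel element `κ` (`toClassGroup_two_eq_one_iff`); hence, for such a `κ` which is a square,
**`(∃ x ∈ Pic(𝒪₂)², x^{#Cl(𝒪_K)²} = κ) ⟺ fourTwoCard (Pic(𝒪₂)) = 2`**
(`exists_isSquare_pow_eq_iff_fourTwoCard_ringClassGroup_two`): the `4`-rank of the form class group of
discriminant `4d_K` is exactly one.

## Why (the consumer)

Tian–Yuan–Zhang 2017 (Prop. 3.2 (1), proof of Lemma 3.21) attach to a block `d ≡ 5 (mod 8)` of a
square-free `n` the ring class field `H′_d = H_{d,2}` of conductor `2` of `K_d = ℚ(√−d)` and the order-two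
element `σ ∈ Gal(H′_d/H_d)`; the cell's Summits file
`Summits/BirchSwinnertonDyer/Rank1Residual/P2/PrintCf2GenusPeriodMoverOfRingClass.lean` proved that the
genus period `Z(d)` is MOVED by an automorphism trivial on the genus field `L_d(i)` iff
`∃ x ∈ Pic(𝒪₂)², x^{g(d)} = κ` (`κ` the image of `σ`, `g(d) = #2Cl(K_d)`).  With this file that
condition becomes the intrinsic invariant «`r₄(Pic(𝒪₂)(ℚ(√−d))) = 1`» (discriminant `−16d`), decidable per
family by Rédei–Reichardt-type computations — the LEAD note
`Summits/…/Cruxes/RamifiedOffTYZOfFacts/Lines/offtyz_v7_QForm.md` §2 (2a) «`c^Z_d ≠ 0 ⟺ e₄(−16d) = 1`».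
Nothing here is specific to elliptic curves; BSD is not proved by any of this.

## References

* [Cox2013] D. A. Cox, *Primes of the form x² + ny²*, 2nd ed. (2013), §7.D Thm. 7.24 and (7.25)–(7.27)
  (`h(𝒪) = h(𝒪_K) f ∏(1 − (d_K/p)/p) / [𝒪_K^× : 𝒪^×]`; the exact sequence
  `1 → (𝒪_K/f)^×/(ℤ/f)^× 𝒪_K^× → Pic(𝒪_f) → Cl(𝒪_K) → 1`), §3.B Prop. 3.11 / Thm. 3.15 (genus theory).
* [TianYuanZhang2017] Y. Tian, X. Yuan, S.-W. Zhang, *Genus periods, genus points and congruent number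
  problem*, Asian J. Math. 21 (2017), Prop. 3.2 (1), proof of Lemma 3.21.
* [Stevenhagen1995RedeiMatrices] P. Stevenhagen, *Rédei-matrices and applications*, LMS LN 215 (1995), §2
  (`4`-ranks of class groups; `2^{r₄} = #(C² ∩ C[2])`).
* [Rotman1995] J. J. Rotman, *An Introduction to the Theory of Groups*, 4th ed., GTM 148 (1995), Thm. 2.19 (PDF p. 37:
  a group of order `pⁿ` is cyclic iff it is abelian with a unique subgroup of order `p`) — the `2`-part of §1.
-/

noncomputable section

open scoped NumberField

open Literature.NumberTheory.EllipticCurves.Tian2014 (fourTwoCard fourTwoCard_def)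

namespace Literature.NumberTheory.QuadraticFields.FourRankOne

universe u

/-! ## §1 Finite abelian groups: `κ` the unique involution ⟺ `κ` is an `m`-th power (`#S = 2m`) -/

section GroupTheory

/-- In a commutative group, `x` is a square iff it lies in the range of `g ↦ g²`. [folklore] -/
private theorem isSquare_iff_mem_range_sq {G : Type*} [CommGroup G] (x : G) :
    IsSquare x ↔ x ∈ (powMonoidHom 2 : G →* G).range := by
  rw [MonoidHom.mem_range]
  constructor
  · rintro ⟨r, hr⟩
    exact ⟨r, by rw [powMonoidHom_apply, pow_two, hr]⟩
  · rintro ⟨r, hr⟩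
    exact ⟨r, by rw [← hr, powMonoidHom_apply, pow_two]⟩

/-- If `κ ≠ 1`, `κ² = 1` and every involution is `1` or `κ`, then `S[2] = {s : s² = 1}` has exactly two
elements (bookkeeping for «a unique subgroup of order `2`»). [cite: Rotman1995, Thm. 2.19 (PDF p. 37)] -/
theorem natCard_sq_eq_one_eq_two {S : Type*} [CommGroup S] {κ : S} (hκ1 : κ ≠ 1) (hκ2 : κ ^ 2 = 1)
    (huniq : ∀ s : S, s ^ 2 = 1 → s = 1 ∨ s = κ) : Nat.card {s : S // s ^ 2 = 1} = 2 := by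
  rw [Nat.card_eq_two_iff]
  refine ⟨⟨1, one_pow 2⟩, ⟨κ, hκ2⟩, fun h => hκ1 (Subtype.ext_iff.mp h).symm, ?_⟩
  ext s
  simp only [Set.mem_insert_iff, Set.mem_singleton_iff, Set.mem_univ, iff_true]
  rcases huniq s.1 s.2 with h | h
  · exact Or.inl (Subtype.ext h)
  · exact Or.inr (Subtype.ext h)

/-- Conversely: if `S[2]` has exactly two elements and `κ ≠ 1` is an involution, every involution is `1`
or `κ` (bookkeeping for «a unique subgroup of order `2`»). [cite: Rotman1995, Thm. 2.19 (PDF p. 37)] -/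
theorem eq_one_or_eq_of_natCard_sq_eq_one_eq_two {S : Type*} [CommGroup S] {κ : S} (hκ1 : κ ≠ 1)
    (hκ2 : κ ^ 2 = 1) (h2 : Nat.card {s : S // s ^ 2 = 1} = 2) (s : S) (hs : s ^ 2 = 1) :
    s = 1 ∨ s = κ := by
  obtain ⟨y, -, hy⟩ := (Nat.card_eq_two_iff' (⟨1, one_pow 2⟩ : {s : S // s ^ 2 = 1})).mp h2
  by_contra h
  obtain ⟨hs1, hsκ⟩ := not_or.mp h
  have hκy := hy ⟨κ, hκ2⟩ fun e => hκ1 (Subtype.ext_iff.mp e)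
  have hsy := hy ⟨s, hs⟩ fun e => hs1 (Subtype.ext_iff.mp e)
  exact hsκ (Subtype.ext_iff.mp (hsy.trans hκy.symm))

/-- **An `m`-th root of the involution `κ` makes `κ` the unique involution** (`#S = 2m`): if `x^m = κ ≠ 1`
then the cyclic group `⟨x⟩` has ODD index in `S` (its order divides `2m` but not `m`), so every `s` with
`s² = 1` lies in `⟨x⟩` (`s = s^{[S:⟨x⟩]} ∈ ⟨x⟩`), and a cyclic group has at most one involution — the
easy half of Rotman's Thm. 2.19 for the `2`-part of `S`, stated without Sylow subgroups.
[cite: Rotman1995, Thm. 2.19 (PDF p. 37: «a group of order pⁿ is cyclic iff it is abelian with a unique subgroup of order p»)] -/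
theorem eq_one_or_eq_of_pow_eq {S : Type*} [CommGroup S] [Finite S] {m : ℕ} (hS : Nat.card S = 2 * m)
    {κ x : S} (hκ1 : κ ≠ 1) (hκ2 : κ ^ 2 = 1) (hx : x ^ m = κ) (s : S) (hs : s ^ 2 = 1) :
    s = 1 ∨ s = κ := by
  classical
  -- `N := orderOf x` divides `2m` but not `m`
  have hx2m : x ^ (2 * m) = 1 := by rw [mul_comm, pow_mul, hx, hκ2]
  have hN2m : orderOf x ∣ 2 * m := orderOf_dvd_of_pow_eq_one hx2m
  have hNm : ¬ orderOf x ∣ m := fun h => hκ1 (by rw [← hx]; exact orderOf_dvd_iff_pow_eq_one.mp h)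
  -- the index of `A = ⟨x⟩` is odd
  set A : Subgroup S := Subgroup.zpowers x with hA
  have hcardA : Nat.card A = orderOf x := Nat.card_zpowers x
  have hci : orderOf x * A.index = 2 * m := by rw [← hcardA, A.card_mul_index, hS]
  have hc_odd : Odd A.index := by
    rcases Nat.even_or_odd A.index with ⟨c', hc'⟩ | hodd
    · exfalso
      apply hNm
      refine ⟨c', Nat.eq_of_mul_eq_mul_left two_pos ?_⟩
      rw [← hci, hc']
      ring
    · exact hodd
  -- hence `s ∈ A`
  have hsA : s ∈ A := by
    have h1 : s ^ A.index ∈ A := A.pow_index_mem s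
    obtain ⟨k, hk⟩ := hc_odd
    rwa [hk, pow_succ, pow_mul, hs, one_pow, one_mul] at h1
  obtain ⟨k, hk⟩ := (Submonoid.mem_powers_iff _ _).mp (mem_powers_iff_mem_zpowers.mpr hsA)
  -- `N` is even, `N = 2N'`
  have hNeven : Even (orderOf x) := by
    by_contra hodd
    rw [Nat.not_even_iff_odd] at hodd
    exact hNm ((Nat.coprime_two_right.mpr hodd).dvd_of_dvd_mul_left hN2m)
  obtain ⟨N', hNN'⟩ := hNeven
  have hN' : orderOf x = 2 * N' := by rw [hNN', two_mul]
  -- `N' ∣ k` (from `s² = 1`) and `N' ∣ m` with odd quotient (from `x^m = κ ≠ 1`)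
  have hx2k : x ^ (2 * k) = 1 := by rw [mul_comm, pow_mul, hk, hs]
  have hN2k : orderOf x ∣ 2 * k := orderOf_dvd_of_pow_eq_one hx2k
  rw [hN'] at hN2k hN2m
  obtain ⟨j, hj⟩ : N' ∣ k := (mul_dvd_mul_iff_left two_ne_zero).mp hN2k
  obtain ⟨i, hi⟩ : N' ∣ m := (mul_dvd_mul_iff_left two_ne_zero).mp hN2m
  have hiodd : Odd i := by
    by_contra he
    rw [Nat.not_odd_iff_even] at he
    obtain ⟨i', hi'⟩ := he
    apply hNm
    refine ⟨i', ?_⟩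
    rw [hi, hN', hi']
    ring
  -- `w := x^{N'}` is an involution, `κ = w`, and `s ∈ {1, w}`
  have hw2 : (x ^ N') ^ 2 = 1 := by rw [← pow_mul, mul_comm, ← hN', pow_orderOf_eq_one]
  have hκw : κ = x ^ N' := by
    rw [← hx, hi, pow_mul, pow_eq_pow_mod i hw2, Nat.odd_iff.mp hiodd, pow_one]
  rw [← hk, hj, pow_mul, pow_eq_pow_mod j hw2]
  rcases Nat.even_or_odd j with he | ho
  · left
    rw [Nat.even_iff.mp he, pow_zero]
  · right
    rw [Nat.odd_iff.mp ho, pow_one, hκw]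

/-- **A unique involution has an `m`-th root** (`#S = 2m`): if `κ ≠ 1`, `κ² = 1` and `κ` is the only
involution of the finite abelian group `S`, then `x^m = κ` for some `x ∈ S`.  Induction on `m`: for `m`
odd take `x = κ`; for `m = 2m′` the squaring map has kernel `{1, κ}`, so its image `S²` has order `m`,
is of even order hence contains an involution (Cauchy), which must be `κ`; by induction `y^{m′} = κ` with
`y = x² ∈ S²`, i.e. `x^m = κ`.  (Equivalently — Rotman's Thm. 2.19 at `p = 2` — the abelian `2`-group `S₂`
with a unique subgroup of order `2` is CYCLIC, of order `2^{a+1}` with `2^a ∥ m`, so a generator `y` has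
`y^m` of order `2`, i.e. `= κ`; the statement here avoids Sylow subgroups.) [cite: Rotman1995, Thm. 2.19 (PDF p. 37: «a group of order pⁿ is cyclic iff it is abelian with a unique subgroup of order p»)] -/
theorem exists_pow_eq_of_forall_sq_eq_one :
    ∀ (m : ℕ) (S : Type u) [CommGroup S] [Finite S], Nat.card S = 2 * m →
      ∀ κ : S, κ ≠ 1 → κ ^ 2 = 1 → (∀ s : S, s ^ 2 = 1 → s = 1 ∨ s = κ) → ∃ x : S, x ^ m = κ := by
  intro m
  induction m using Nat.strong_induction_on with
  | _ m ih =>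
  intro S _ _ hS κ hκ1 hκ2 huniq
  classical
  rcases Nat.even_or_odd m with ⟨m', hm'⟩ | hodd
  · -- `m = m' + m'`
    have hpos : 0 < Nat.card S := Nat.card_pos
    have hm'lt : m' < m := by omega
    let sq : S →* S := powMonoidHom 2
    have hker : ∀ s : S, s ∈ sq.ker ↔ s ^ 2 = 1 := fun s => by
      rw [MonoidHom.mem_ker, powMonoidHom_apply]
    have hcardker : Nat.card sq.ker = 2 := by
      rw [Nat.card_congr (Equiv.subtypeEquivRight hker)]
      exact natCard_sq_eq_one_eq_two hκ1 hκ2 huniq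
    have hcardR : Nat.card sq.range = m := by
      have h := sq.ker.card_mul_index
      rw [Subgroup.index_ker, hcardker, hS] at h
      omega
    -- `κ ∈ S²` by Cauchy
    have hκR : κ ∈ sq.range := by
      haveI : Fact (Nat.Prime 2) := ⟨Nat.prime_two⟩
      obtain ⟨y, hy⟩ := exists_prime_orderOf_dvd_card' (G := sq.range) 2
        (by rw [hcardR, hm']; exact ⟨m', by ring⟩)
      have hy2 : (y : S) ^ 2 = 1 := by
        have h := pow_orderOf_eq_one y
        rw [hy] at h
        have h' := congrArg Subtype.val h
        simpa using h'
      have hy1 : (y : S) ≠ 1 := by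
        intro h
        have h1 : y = 1 := Subtype.ext (by simpa using h)
        rw [h1, orderOf_one] at hy
        exact absurd hy (by norm_num)
      rcases huniq y hy2 with h | h
      · exact absurd h hy1
      · rw [← h]; exact y.2
    -- induction hypothesis in `S²`
    have huniq' : ∀ s : sq.range, s ^ 2 = 1 → s = 1 ∨ s = ⟨κ, hκR⟩ := by
      intro s hs
      have hs' : (s : S) ^ 2 = 1 := by
        have h' := congrArg Subtype.val hs
        simpa using h'
      rcases huniq s hs' with h | h
      · left; exact Subtype.ext (by simpa using h)
      · right; exact Subtype.ext (by simpa using h)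
    obtain ⟨y, hy⟩ := ih m' hm'lt sq.range (by rw [hcardR, hm', two_mul]) ⟨κ, hκR⟩
      (fun h => hκ1 (by simpa using congrArg Subtype.val h)) (Subtype.ext (by simpa using hκ2)) huniq'
    obtain ⟨x, hx⟩ := y.2
    refine ⟨x, ?_⟩
    have hym : (y : S) ^ m' = κ := by
      have h' := congrArg Subtype.val hy
      simpa using h'
    rw [hm', ← two_mul, pow_mul, ← hym, ← hx, powMonoidHom_apply]
  · obtain ⟨k, hk⟩ := hodd
    exact ⟨κ, by rw [hk, pow_succ, pow_mul, hκ2, one_pow, one_mul]⟩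

/-- **The criterion**: in a finite abelian group `S` of order `2m` with an involution `κ ≠ 1`,
`κ` is an `m`-th power iff `κ` is the only involution (⟺ the `2`-part of `S` is cyclic, Rotman Thm. 2.19).
[cite: Rotman1995, Thm. 2.19 (PDF p. 37)] -/
theorem exists_pow_eq_iff_forall_sq_eq_one {S : Type u} [CommGroup S] [Finite S] {m : ℕ}
    (hS : Nat.card S = 2 * m) {κ : S} (hκ1 : κ ≠ 1) (hκ2 : κ ^ 2 = 1) :
    (∃ x : S, x ^ m = κ) ↔ ∀ s : S, s ^ 2 = 1 → s = 1 ∨ s = κ :=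
  ⟨fun ⟨_, hx⟩ s hs => eq_one_or_eq_of_pow_eq hS hκ1 hκ2 hx s hs,
    fun h => exists_pow_eq_of_forall_sq_eq_one m S hS κ hκ1 hκ2 h⟩

/-- **The criterion, counted**: in a finite abelian group `S` of order `2m` with an involution `κ ≠ 1`,
`κ` is an `m`-th power iff `#S[2] = 2` (⟺ the `2`-part of `S` is cyclic, Rotman Thm. 2.19). [cite: Rotman1995, Thm. 2.19 (PDF p. 37)] -/
theorem exists_pow_eq_iff_natCard_sq_eq_one_eq_two {S : Type u} [CommGroup S] [Finite S] {m : ℕ}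
    (hS : Nat.card S = 2 * m) {κ : S} (hκ1 : κ ≠ 1) (hκ2 : κ ^ 2 = 1) :
    (∃ x : S, x ^ m = κ) ↔ Nat.card {s : S // s ^ 2 = 1} = 2 := by
  rw [exists_pow_eq_iff_forall_sq_eq_one hS hκ1 hκ2]
  exact ⟨natCard_sq_eq_one_eq_two hκ1 hκ2, eq_one_or_eq_of_natCard_sq_eq_one_eq_two hκ1 hκ2⟩

/-- **`4`-rank ONE**: let `π : G ↠ C` be a surjection of finite abelian groups whose kernel is `{1, κ}`
with `κ ≠ 1` a SQUARE, and let `g = #C²` be the number of squares of `C`.  Then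
`(∃ x ∈ G², x^g = κ) ⟺ fourTwoCard G = 2` (`#(G² ∩ G[2]) = 2`, i.e. `r₄(G) = 1`).  Proof: `S := G²` maps
onto `C²` with kernel `{1, κ}`, so `#S = 2g`; and `S[2] = G² ∩ G[2]`; apply
`exists_pow_eq_iff_natCard_sq_eq_one_eq_two` (the `2`-part of `G²` is cyclic iff it has a unique subgroup of
order `2`, Rotman Thm. 2.19; `#(G² ∩ G[2]) = 2^{r₄(G)}`, Stevenhagen §2).
[cite: Rotman1995, Thm. 2.19 (PDF p. 37)] [cite: Stevenhagen1995RedeiMatrices, §2 (proof of Thm. 1: r₄ and C² ∩ C[2])] -/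
theorem exists_isSquare_pow_eq_iff_fourTwoCard_eq_two {G : Type u} {C : Type*} [CommGroup G] [Finite G]
    [CommGroup C] (π : G →* C) (hπ : Function.Surjective π) {κ : G}
    (hker : ∀ x : G, π x = 1 ↔ x = 1 ∨ x = κ) (hκ1 : κ ≠ 1) (hκsq : IsSquare κ) :
    (∃ x : G, IsSquare x ∧ x ^ Nat.card {c : C // IsSquare c} = κ) ↔ fourTwoCard G = 2 := by
  classical
  have hπκ : π κ = 1 := (hker κ).mpr (Or.inr rfl)
  have hκ2 : κ ^ 2 = 1 := by
    rcases (hker (κ ^ 2)).mp (by rw [map_pow, hπκ, one_pow]) with h | h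
    · exact h
    · rw [pow_two] at h
      exact absurd (mul_left_cancel (h.trans (mul_one κ).symm)) hκ1
  -- `S = G²`
  set S : Subgroup G := (powMonoidHom 2 : G →* G).range with hSdef
  have hmemS : ∀ x : G, x ∈ S ↔ IsSquare x := fun x => (isSquare_iff_mem_range_sq x).symm
  have hκS : κ ∈ S := (hmemS κ).mpr hκsq
  -- `#S = 2 g` through `ψ = π|_S : S → C`, kernel `{1, κ}`, image `C²`
  let ψ : S →* C := π.comp S.subtype
  have hψapply : ∀ s : S, ψ s = π s := fun s => rfl
  have hψker : Nat.card ψ.ker = 2 := by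
    rw [Nat.card_eq_two_iff]
    refine ⟨1, ⟨⟨κ, hκS⟩, by rw [MonoidHom.mem_ker, hψapply]; exact hπκ⟩, ?_, ?_⟩
    · intro h
      have h' := congrArg (fun z : ψ.ker => ((z : S) : G)) h
      exact hκ1 (by simpa using h'.symm)
    · ext z
      simp only [Set.mem_insert_iff, Set.mem_singleton_iff, Set.mem_univ, iff_true]
      have hz : π ((z : S) : G) = 1 := by rw [← hψapply]; exact z.2
      rcases (hker _).mp hz with h | h
      · left
        exact Subtype.ext (Subtype.ext (by simpa using h))
      · right
        exact Subtype.ext (Subtype.ext (by simpa using h))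
  have hψrange : Nat.card ψ.range = Nat.card {c : C // IsSquare c} := by
    refine Nat.card_congr (Equiv.subtypeEquivRight fun c => ?_)
    rw [MonoidHom.mem_range]
    constructor
    · rintro ⟨⟨s, hs⟩, rfl⟩
      obtain ⟨r, hr⟩ := (hmemS s).mp hs
      exact ⟨π r, by rw [hψapply]; change π s = _; rw [hr, map_mul]⟩
    · rintro ⟨r, hr⟩
      obtain ⟨y, rfl⟩ := hπ r
      exact ⟨⟨y * y, (hmemS _).mpr ⟨y, rfl⟩⟩, by rw [hψapply]; change π (y * y) = _; rw [hr, map_mul]⟩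
  have hcardS : Nat.card S = 2 * Nat.card {c : C // IsSquare c} := by
    have h := ψ.ker.card_mul_index
    rw [Subgroup.index_ker, hψker, hψrange] at h
    exact h.symm
  -- `fourTwoCard G = #S[2]`
  have h42 : fourTwoCard G = Nat.card {s : S // s ^ 2 = 1} := by
    rw [fourTwoCard_def]
    refine Nat.card_congr
      { toFun := fun a => ⟨⟨a.1, (hmemS _).mpr a.2.1⟩, Subtype.ext (by simpa using a.2.2)⟩
        invFun := fun s => ⟨(s.1 : G), (hmemS _).mp s.1.2, by
          have h' := congrArg Subtype.val s.2
          simpa using h'⟩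
        left_inv := fun a => rfl
        right_inv := fun s => rfl }
  rw [h42, ← exists_pow_eq_iff_natCard_sq_eq_one_eq_two (S := S) hcardS (κ := ⟨κ, hκS⟩)
    (fun h => hκ1 (by simpa using congrArg Subtype.val h)) (Subtype.ext (by simpa using hκ2))]
  constructor
  · rintro ⟨x, hxsq, hxpow⟩
    exact ⟨⟨x, (hmemS x).mpr hxsq⟩, Subtype.ext (by simpa using hxpow)⟩
  · rintro ⟨x, hx⟩
    refine ⟨x, (hmemS _).mp x.2, ?_⟩
    have h' := congrArg Subtype.val hx
    simpa using h'

/-- The trivial sufficient condition: if `g` is odd (no squares of even order, `r₄ = 0` on the base) then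
`x = κ` itself works: `κ` a square with `κ² = 1` has `κ^g = κ` (the trivial case of the criterion
`exists_isSquare_pow_eq_iff_fourTwoCard_eq_two`). [cite: Rotman1995, Thm. 2.19 (PDF p. 37)] -/
theorem exists_isSquare_pow_eq_of_odd {G : Type*} [CommGroup G] {κ : G} (hκsq : IsSquare κ)
    (hκ2 : κ ^ 2 = 1) {g : ℕ} (hg : Odd g) : ∃ x : G, IsSquare x ∧ x ^ g = κ := by
  obtain ⟨k, hk⟩ := hg
  exact ⟨κ, hκsq, by rw [hk, pow_succ, pow_mul, hκ2, one_pow, one_mul]⟩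

/-! ### The `4`-rank-one condition read on the base `C` -/

/-- **The `4`-rank-one condition read on the base.**  In the setting of
`exists_isSquare_pow_eq_iff_fourTwoCard_eq_two` (`π : G ↠ C`, `ker π = {1, κ}`, `κ ≠ 1` a square):
**`fourTwoCard G = 2 ⟺ fourTwoCard C = 1 ∨ (fourTwoCard C = 2 ∧ ∃ s ∈ G², s² = κ)`** — i.e. `r₄(G) = 1` iff
EITHER `r₄(C) = 0`, OR `r₄(C) = 1` and `κ` is a fourth power.  Proof (counting in `S = G²`): the subgroup
`B = {s ∈ S : π(s)² = 1}` maps onto `C² ∩ C[2]` with kernel `{1, κ}`, so `#B = 2·fourTwoCard C`; squaring maps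
`B` into `{1, κ}` with kernel `S[2] = G² ∩ G[2]`, so `#B = fourTwoCard G · r` with `r = 2` or `1` according as
`κ` is or is not the square of a square; and `fourTwoCard G ≥ 2` (`1, κ ∈ S[2]`).  (For `r₄(C) ≥ 2` the
`4`-rank of `G` is never `1`.)  [cite: Rotman1995, Thm. 2.19 (PDF p. 37)]
[cite: Stevenhagen1995RedeiMatrices, §2 (proof of Thm. 1: r₄ and C² ∩ C[2])] -/
theorem fourTwoCard_eq_two_iff_base {G : Type u} {C : Type*} [CommGroup G] [Finite G] [CommGroup C]
    (π : G →* C) (hπ : Function.Surjective π) {κ : G}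
    (hker : ∀ x : G, π x = 1 ↔ x = 1 ∨ x = κ) (hκ1 : κ ≠ 1) (hκsq : IsSquare κ) :
    fourTwoCard G = 2 ↔
      fourTwoCard C = 1 ∨ (fourTwoCard C = 2 ∧ ∃ s : G, IsSquare s ∧ s ^ 2 = κ) := by
  classical
  have hπκ : π κ = 1 := (hker κ).mpr (Or.inr rfl)
  have hκ2 : κ ^ 2 = 1 := by
    rcases (hker (κ ^ 2)).mp (by rw [map_pow, hπκ, one_pow]) with h | h
    · exact h
    · rw [pow_two] at h
      exact absurd (mul_left_cancel (h.trans (mul_one κ).symm)) hκ1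
  -- `S = G²`
  set S : Subgroup G := (powMonoidHom 2 : G →* G).range with hSdef
  have hmemS : ∀ x : G, x ∈ S ↔ IsSquare x := fun x => (isSquare_iff_mem_range_sq x).symm
  have hκS : κ ∈ S := (hmemS κ).mpr hκsq
  let ψ : S →* C := π.comp S.subtype
  have hψapply : ∀ s : S, ψ s = π s := fun s => rfl
  -- `B = {s ∈ S : π(s)² = 1}`
  set B : Subgroup S := ((powMonoidHom 2 : C →* C).ker).comap ψ with hBdef
  have hmemB : ∀ s : S, s ∈ B ↔ π s ^ 2 = 1 := fun s => by
    rw [hBdef, Subgroup.mem_comap, MonoidHom.mem_ker, powMonoidHom_apply, hψapply]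
  have hκB : (⟨κ, hκS⟩ : S) ∈ B := by
    rw [hmemB]; change π κ ^ 2 = 1; rw [hπκ, one_pow]
  -- (a) `#B = 2 · fourTwoCard C`
  let ψB : B →* C := ψ.comp B.subtype
  have hψB : ∀ b : B, ψB b = π ((b : S) : G) := fun b => rfl
  have hψBker : Nat.card ψB.ker = 2 := by
    rw [Nat.card_eq_two_iff]
    refine ⟨1, ⟨⟨⟨κ, hκS⟩, hκB⟩, by rw [MonoidHom.mem_ker, hψB]; exact hπκ⟩, ?_, ?_⟩
    · intro h
      have h' := congrArg (fun z : ψB.ker => (((z : B) : S) : G)) h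
      exact hκ1 (by simpa using h'.symm)
    · ext z
      simp only [Set.mem_insert_iff, Set.mem_singleton_iff, Set.mem_univ, iff_true]
      have hz : π (((z : B) : S) : G) = 1 := by rw [← hψB]; exact z.2
      rcases (hker _).mp hz with h | h
      · left
        exact Subtype.ext (Subtype.ext (Subtype.ext (by simpa using h)))
      · right
        exact Subtype.ext (Subtype.ext (Subtype.ext (by simpa using h)))
  have hψBrange : Nat.card ψB.range = fourTwoCard C := by
    rw [fourTwoCard_def]
    refine Nat.card_congr (Equiv.subtypeEquivRight fun c => ?_)
    rw [MonoidHom.mem_range]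
    constructor
    · rintro ⟨⟨⟨s, hs⟩, hsB⟩, rfl⟩
      obtain ⟨r, hr⟩ := (hmemS s).mp hs
      refine ⟨⟨π r, ?_⟩, ?_⟩
      · rw [hψB]; change π s = _; rw [hr, map_mul]
      · rw [hψB]; exact (hmemB _).mp hsB
    · rintro ⟨⟨r, hr⟩, hc2⟩
      obtain ⟨y, rfl⟩ := hπ r
      have hyyS : y * y ∈ S := (hmemS _).mpr ⟨y, rfl⟩
      have hyyB : (⟨y * y, hyyS⟩ : S) ∈ B := by
        rw [hmemB]; change π (y * y) ^ 2 = 1; rw [map_mul, ← hr, hc2]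
      exact ⟨⟨⟨y * y, hyyS⟩, hyyB⟩, by rw [hψB]; change π (y * y) = _; rw [hr, map_mul]⟩
  have hcardB : Nat.card B = 2 * fourTwoCard C := by
    have h := ψB.ker.card_mul_index
    rw [Subgroup.index_ker, hψBker, hψBrange] at h
    exact h.symm
  -- (b) squaring on `B`: kernel `S[2] = G² ∩ G[2]`, image `⊆ {1, κ}`
  let sqB : B →* S := (powMonoidHom 2 : S →* S).comp B.subtype
  have hsqB : ∀ b : B, sqB b = (b : S) ^ 2 := fun b => rfl
  have hsqBker : Nat.card sqB.ker = fourTwoCard G := by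
    rw [fourTwoCard_def]
    refine Nat.card_congr
      { toFun := fun z => ⟨(((z : B) : S) : G), (hmemS _).mp ((z : B) : S).2, by
          have h1 : ((z : B) : S) ^ 2 = 1 := by rw [← hsqB]; exact z.2
          have h2 := congrArg Subtype.val h1
          simpa using h2⟩
        invFun := fun a => ⟨⟨⟨a.1, (hmemS _).mpr a.2.1⟩, by
            rw [hmemB]; change π a.1 ^ 2 = 1; rw [← map_pow, a.2.2, map_one]⟩, by
            rw [MonoidHom.mem_ker, hsqB]; exact Subtype.ext (by simpa using a.2.2)⟩
        left_inv := fun z => rfl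
        right_inv := fun a => rfl }
  have hrange_sub : ∀ t : S, t ∈ sqB.range → t = 1 ∨ t = ⟨κ, hκS⟩ := by
    rintro t ⟨b, rfl⟩
    have hb : π ((b : S) : G) ^ 2 = 1 := (hmemB _).mp b.2
    rw [← map_pow] at hb
    rcases (hker _).mp hb with h | h
    · left
      rw [hsqB]; exact Subtype.ext (by simpa using h)
    · right
      rw [hsqB]; exact Subtype.ext (by simpa using h)
  have hex_iff : (⟨κ, hκS⟩ : S) ∈ sqB.range ↔ ∃ s : G, IsSquare s ∧ s ^ 2 = κ := by
    constructor
    · rintro ⟨b, hb⟩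
      refine ⟨((b : S) : G), (hmemS _).mp ((b : S)).2, ?_⟩
      have h' := congrArg Subtype.val hb
      simpa [hsqB] using h'
    · rintro ⟨s, hs, hs2⟩
      have hsS : s ∈ S := (hmemS s).mpr hs
      have hsB : (⟨s, hsS⟩ : S) ∈ B := by
        rw [hmemB]; change π s ^ 2 = 1; rw [← map_pow, hs2, hπκ]
      exact ⟨⟨⟨s, hsS⟩, hsB⟩, Subtype.ext (by simpa [hsqB] using hs2)⟩
  have hcard_range :
      Nat.card sqB.range = if (∃ s : G, IsSquare s ∧ s ^ 2 = κ) then 2 else 1 := by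
    split_ifs with hex
    · rw [Nat.card_eq_two_iff]
      refine ⟨1, ⟨⟨κ, hκS⟩, hex_iff.mpr hex⟩, ?_, ?_⟩
      · intro h
        have h' := congrArg (fun z : sqB.range => ((z : S) : G)) h
        exact hκ1 (by simpa using h'.symm)
      · ext z
        simp only [Set.mem_insert_iff, Set.mem_singleton_iff, Set.mem_univ, iff_true]
        rcases hrange_sub z z.2 with h | h
        · left
          exact Subtype.ext (by simpa using h)
        · right
          exact Subtype.ext h
    · rw [Nat.card_eq_one_iff_unique]
      refine ⟨⟨fun a b => ?_⟩, ⟨1⟩⟩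
      have key : ∀ z : sqB.range, (z : S) = 1 := fun z => by
        rcases hrange_sub z z.2 with h | h
        · exact h
        · exact absurd (hex_iff.mp (h ▸ z.2)) hex
      exact Subtype.ext ((key a).trans (key b).symm)
  have hcardB' : Nat.card B = fourTwoCard G * Nat.card sqB.range := by
    have h := sqB.ker.card_mul_index
    rw [Subgroup.index_ker, hsqBker] at h
    exact h.symm
  -- (c) `fourTwoCard G ≥ 2` (`1, κ ∈ G² ∩ G[2]`)
  have hA2 : 2 ≤ fourTwoCard G := by
    rw [fourTwoCard_def]
    have h2 : Nat.card {a : G // a = 1 ∨ a = κ} = 2 := by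
      rw [Nat.card_eq_two_iff]
      refine ⟨⟨1, Or.inl rfl⟩, ⟨κ, Or.inr rfl⟩, fun h => hκ1 (Subtype.ext_iff.mp h).symm, ?_⟩
      ext a
      simp only [Set.mem_insert_iff, Set.mem_singleton_iff, Set.mem_univ, iff_true]
      rcases a.2 with h | h
      · exact Or.inl (Subtype.ext h)
      · exact Or.inr (Subtype.ext h)
    have hle : Nat.card {a : G // a = 1 ∨ a = κ} ≤ Nat.card {a : G // IsSquare a ∧ a ^ 2 = 1} := by
      refine Nat.card_le_card_of_injective
        (fun a => ⟨a.1, by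
          rcases a.2 with h | h
          · rw [h]; exact ⟨⟨1, (mul_one 1).symm⟩, one_pow 2⟩
          · rw [h]; exact ⟨hκsq, hκ2⟩⟩) ?_
      intro a b hab
      exact Subtype.ext (by simpa using congrArg Subtype.val hab)
    omega
  -- (d) arithmetic: `fourTwoCard G · r = 2 · fourTwoCard C`
  rw [hcardB', hcard_range] at hcardB
  constructor
  · intro hG
    rw [hG] at hcardB
    by_cases hex : ∃ s : G, IsSquare s ∧ s ^ 2 = κ
    · rw [if_pos hex] at hcardB
      exact Or.inr ⟨by omega, hex⟩
    · rw [if_neg hex] at hcardB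
      exact Or.inl (by omega)
  · rintro (hC | ⟨hC, hex⟩)
    · rw [hC] at hcardB
      by_cases hex : ∃ s : G, IsSquare s ∧ s ^ 2 = κ
      · rw [if_pos hex] at hcardB
        omega
      · rw [if_neg hex] at hcardB
        omega
    · rw [hC, if_pos hex] at hcardB
      omega

/-- **No mover when the base has `4`-rank `≥ 2`**: in the same setting, if `fourTwoCard C ≠ 1` and
`fourTwoCard C ≠ 2` (i.e. `r₄(C) ≥ 2`) then `fourTwoCard G ≠ 2`, so no square `x` has `x^{#C²} = κ`.
[cite: Rotman1995, Thm. 2.19 (PDF p. 37)] [cite: Stevenhagen1995RedeiMatrices, §2] -/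
theorem not_exists_isSquare_pow_eq_of_fourTwoCard_base {G : Type u} {C : Type*} [CommGroup G] [Finite G]
    [CommGroup C] (π : G →* C) (hπ : Function.Surjective π) {κ : G}
    (hker : ∀ x : G, π x = 1 ↔ x = 1 ∨ x = κ) (hκ1 : κ ≠ 1) (hκsq : IsSquare κ)
    (h1 : fourTwoCard C ≠ 1) (h2 : fourTwoCard C ≠ 2) :
    ¬ ∃ x : G, IsSquare x ∧ x ^ Nat.card {c : C // IsSquare c} = κ := by
  rw [exists_isSquare_pow_eq_iff_fourTwoCard_eq_two π hπ hker hκ1 hκsq,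
    fourTwoCard_eq_two_iff_base π hπ hker hκ1 hκsq]
  rintro (h | ⟨h, -⟩)
  · exact h1 h
  · exact h2 h

/-- **`r₄(C) = 1`: the criterion is «`κ` is a fourth power»**: in the same setting, if `fourTwoCard C = 2`
then `(∃ x ∈ G², x^{#C²} = κ) ⟺ ∃ s ∈ G², s² = κ`.
[cite: Rotman1995, Thm. 2.19 (PDF p. 37)] [cite: Stevenhagen1995RedeiMatrices, §2] -/
theorem exists_isSquare_pow_eq_iff_exists_sq_eq_of_fourTwoCard_base_eq_two {G : Type u} {C : Type*}
    [CommGroup G] [Finite G] [CommGroup C] (π : G →* C) (hπ : Function.Surjective π) {κ : G}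
    (hker : ∀ x : G, π x = 1 ↔ x = 1 ∨ x = κ) (hκ1 : κ ≠ 1) (hκsq : IsSquare κ)
    (h2 : fourTwoCard C = 2) :
    (∃ x : G, IsSquare x ∧ x ^ Nat.card {c : C // IsSquare c} = κ) ↔
      ∃ s : G, IsSquare s ∧ s ^ 2 = κ := by
  rw [exists_isSquare_pow_eq_iff_fourTwoCard_eq_two π hπ hker hκ1 hκsq,
    fourTwoCard_eq_two_iff_base π hπ hker hκ1 hκsq, h2]
  constructor
  · rintro (h | ⟨-, h⟩)
    · exact absurd h (by norm_num)
    · exact h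
  · exact fun h => Or.inr ⟨rfl, h⟩

/-- **`r₄(C) = 0`: the criterion holds** (equivalently `#C²` is odd; cf. `exists_isSquare_pow_eq_of_odd`).
[cite: Rotman1995, Thm. 2.19 (PDF p. 37)] [cite: Stevenhagen1995RedeiMatrices, §2] -/
theorem exists_isSquare_pow_eq_of_fourTwoCard_base_eq_one {G : Type u} {C : Type*}
    [CommGroup G] [Finite G] [CommGroup C] (π : G →* C) (hπ : Function.Surjective π) {κ : G}
    (hker : ∀ x : G, π x = 1 ↔ x = 1 ∨ x = κ) (hκ1 : κ ≠ 1) (hκsq : IsSquare κ)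
    (h1 : fourTwoCard C = 1) :
    ∃ x : G, IsSquare x ∧ x ^ Nat.card {c : C // IsSquare c} = κ := by
  rw [exists_isSquare_pow_eq_iff_fourTwoCard_eq_two π hπ hker hκ1 hκsq,
    fourTwoCard_eq_two_iff_base π hπ hker hκ1 hκsq]
  exact Or.inl h1

end GroupTheory

/-! ## §2 The conductor-`2` ring class group of an imaginary quadratic field with even discriminant -/

section ConductorTwo

open Module NumberField
open Literature.NumberTheory.QuadraticFields.RingClass Literature.NumberTheory.QuadraticFields.Quadratic
open Literature.NumberTheory.EllipticCurves (isImaginaryQuadratic_iff_isCMField isImaginaryQuadratic_iff_discr_neg)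
open Literature.NumberTheory.ComplexMultiplication

variable {K : Type} [Field K] [NumberField K]

/-- **`I_K(f)/P_{K,ℤ}(f) → Cl(𝒪_K)` is onto** for an imaginary quadratic field (`[K:ℚ] = 2`, `d_K < 0`) and
every conductor `f ≥ 1` — the tree's `RingClass.toClassGroup_surjective` (Cox (7.25): every class contains
an ideal prime to `f`) on an integral basis `(1, ω)`. [cite: Cox2013, §7.D (7.25) and §2.C Lemma 2.25] -/
theorem toClassGroup_surjective_of_discr_neg (h2 : finrank ℚ K = 2) (hd : NumberField.discr K < 0)
    {f : ℕ} (hf : f ≠ 0) : Function.Surjective (toClassGroup K f) := by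
  obtain ⟨b, hb⟩ := exists_basis_zero_eq_one h2
  have hω := basis_one_mul_self_eq b hb
  have hD := discr_eq_sq_add_four_mul b hb
  exact toClassGroup_surjective b hb hω (by rw [← hD]; exact hd) hf

/-- **`ker(Pic(𝒪₂) → Cl(𝒪_K)) = {1, κ}`** for `d_K` even, `d_K ≠ −4` (`d_K < 0`, `[K:ℚ] = 2`) and ANY
non-trivial kernel element `κ`: the kernel has order `h(𝒪₂)/h(𝒪_K) = 2` (Cox Thm. 7.24 with `(d_K/2) = 0`,
`𝒪_K^× = 𝒪₂^× = {±1}`; tree `CMTypeLattice.natCard_ker_toClassGroup_two_pow_of_even`).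
[cite: Cox2013, §7.D Thm. 7.24 and (7.27), pp. 146–148] -/
theorem toClassGroup_two_eq_one_iff (h2 : finrank ℚ K = 2) (hd : NumberField.discr K < 0)
    (heven : Even (NumberField.discr K)) (hd4 : NumberField.discr K ≠ -4) {κ : RingClassGroup K 2}
    (hκ : toClassGroup K 2 κ = 1) (hκ1 : κ ≠ 1) (x : RingClassGroup K 2) :
    toClassGroup K 2 x = 1 ↔ x = 1 ∨ x = κ := by
  haveI : IsCMField K := (isImaginaryQuadratic_iff_isCMField.mp
    (isImaginaryQuadratic_iff_discr_neg.mpr ⟨h2, hd⟩)).2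
  have hcard : Nat.card (toClassGroup K 2).ker = 2 := by
    simpa using CMTypeLattice.natCard_ker_toClassGroup_two_pow_of_even h2 heven hd4 (le_refl 1)
  obtain ⟨y, -, hy⟩ := (Nat.card_eq_two_iff' (1 : (toClassGroup K 2).ker)).mp hcard
  constructor
  · intro hx
    by_contra h
    obtain ⟨hx1, hxκ⟩ := not_or.mp h
    have hκy := hy ⟨κ, hκ⟩ fun e => hκ1 (by simpa using congrArg Subtype.val e)
    have hxy := hy ⟨x, hx⟩ fun e => hx1 (by simpa using congrArg Subtype.val e)
    exact hxκ (by simpa using congrArg Subtype.val (hxy.trans hκy.symm))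
  · rintro (rfl | rfl)
    · exact map_one _
    · exact hκ

/-- **The `4`-rank-one criterion on `Pic(𝒪₂)`** (`[K:ℚ] = 2`, `d_K < 0` even, `d_K ≠ −4`): for a
non-trivial `κ ∈ ker(Pic(𝒪₂) → Cl(𝒪_K))` which is a square in `Pic(𝒪₂) = I_K(2)/P_{K,ℤ}(2)`,
`(∃ x ∈ Pic(𝒪₂)², x^{#Cl(𝒪_K)²} = κ) ⟺ fourTwoCard (Pic(𝒪₂)) = 2` — the `4`-rank of the class group of
discriminant `4d_K` is exactly one.  (For `K = ℚ(√−d)`, `d ≡ 1 (mod 4)`: `κ = [(√−d)]`, the exponent is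
`g(d) = #2Cl(K)`, and the condition is «`e₄(−16d) = 1`» of the Tian–Yuan–Zhang transfer layer.)
[cite: Cox2013, §7.D Thm. 7.24 and (7.25)–(7.27)] [cite: TianYuanZhang2017, Prop. 3.2 (1) and proof of Lemma 3.21 (p. 759)]
[cite: Stevenhagen1995RedeiMatrices, §2] -/
theorem exists_isSquare_pow_eq_iff_fourTwoCard_ringClassGroup_two (h2 : finrank ℚ K = 2)
    (hd : NumberField.discr K < 0) (heven : Even (NumberField.discr K)) (hd4 : NumberField.discr K ≠ -4)
    {κ : RingClassGroup K 2} (hκ : toClassGroup K 2 κ = 1) (hκ1 : κ ≠ 1) (hκsq : IsSquare κ) :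
    (∃ x : RingClassGroup K 2, IsSquare x ∧ x ^ Nat.card {c : ClassGroup (𝓞 K) // IsSquare c} = κ) ↔
      fourTwoCard (RingClassGroup K 2) = 2 := by
  haveI := finite_ringClassGroup (K := K) h2 two_ne_zero
  exact exists_isSquare_pow_eq_iff_fourTwoCard_eq_two (toClassGroup K 2)
    (toClassGroup_surjective_of_discr_neg h2 hd two_ne_zero) (toClassGroup_two_eq_one_iff h2 hd heven hd4 hκ hκ1)
    hκ1 hκsq

/-- The kernel element squares to one: `κ² = 1` for every `κ ∈ ker(Pic(𝒪₂) → Cl(𝒪_K))` (`d_K` even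
`≠ −4`: the kernel has order `2`). [cite: Cox2013, §7.D Thm. 7.24 and (7.27)] -/
theorem sq_eq_one_of_toClassGroup_two_eq_one (h2 : finrank ℚ K = 2) (hd : NumberField.discr K < 0)
    (heven : Even (NumberField.discr K)) (hd4 : NumberField.discr K ≠ -4) {κ : RingClassGroup K 2}
    (hκ : toClassGroup K 2 κ = 1) : κ ^ 2 = 1 := by
  by_cases hκ1 : κ = 1
  · rw [hκ1, one_pow]
  rcases (toClassGroup_two_eq_one_iff h2 hd heven hd4 hκ hκ1 (κ ^ 2)).mp
    (by rw [map_pow, hκ, one_pow]) with h | h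
  · exact h
  · rw [pow_two] at h
    have h' := congrArg (fun y => κ⁻¹ * y) h
    simp only [inv_mul_cancel_left, inv_mul_cancel] at h'
    exact absurd h' hκ1

/-- **Odd genus class number ⟹ the criterion holds trivially** (`r₄(Cl(𝒪_K)) = 0`): if `#Cl(𝒪_K)²` is
odd then `x = κ` works. [cite: TianYuanZhang2017, Thm. 1.2 and proof of Lemma 3.21 (the case g(n) odd)] -/
theorem exists_isSquare_pow_eq_ringClassGroup_two_of_odd (h2 : finrank ℚ K = 2)
    (hd : NumberField.discr K < 0) (heven : Even (NumberField.discr K)) (hd4 : NumberField.discr K ≠ -4)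
    {κ : RingClassGroup K 2} (hκ : toClassGroup K 2 κ = 1) (hκsq : IsSquare κ)
    (hodd : Odd (Nat.card {c : ClassGroup (𝓞 K) // IsSquare c})) :
    ∃ x : RingClassGroup K 2, IsSquare x ∧ x ^ Nat.card {c : ClassGroup (𝓞 K) // IsSquare c} = κ :=
  exists_isSquare_pow_eq_of_odd (G := RingClassGroup K 2) hκsq
    (sq_eq_one_of_toClassGroup_two_eq_one h2 hd heven hd4 hκ) hodd

end ConductorTwo

end Literature.NumberTheory.QuadraticFields.FourRankOne

end
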